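import Literature.Probability.Percolation.PercolationEvents
import Mathlib.Data.Finset.Image
import Mathlib.Order.UpperLower.Basic
import HarnessLib

/-!
# One-step scheme: VERTEX-COVER (monotone 2-CNF) EVENTS and their sections

Support file (prover prim-ineq-prove-3 gen 37; `--supports stmt-CriticalPhenomena-4575`; memo
`run/shared/lean/prim/prim-ineq-prove-3/PROOF-G37-VERTEX-COVER-PARTNERS.md` §1.2).  No definitions, no named facts, no sorries.

A vertex-cover event is `{ω | Sp ⊆ ω ∧ ∀ (a,b) ∈ E, a ∈ ω ∨ b ∈ ω}` for a forced set `Sp : Finset ι` and an edge list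
`E : Finset (ι × ι)` (loops `(a,a)` allowed = unit clauses) — an increasing event generated by sets of size `≤ 2`.  The event is
always written out (no definition).  This file records the elementary set identities used by the class induction of
`…SahiOneStepTwoCNF`: the events are increasing and `F`-determined when the data lie in `F` (`isUpperSet_vc`, `determinedBy_vc`);
the inner section at `e` deletes `e` (`section_insert_vc`); the outer section at a forced coordinate or a loop vertex is `∅`
(`section_sdiff_vc_of_mem`, `section_sdiff_vc_of_loop`) and at a proper vertex forces its neighbours (`section_sdiff_vc`);
forcing a set is intersecting with a principal up-set (`vc_eq_inter_supset`).
-/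

namespace Summit.CriticalPhenomena.PercolationContinuityZ3.Theorems

namespace SahiOneStep

open Finset
open scoped Classical

variable {ι : Type*}


/-! ## Vertex-cover (2-CNF) events and their sections -/
section TwoCNF

open Literature.Probability.Percolation (DeterminedBy determinedBy_iff)

/-- Vertex-cover events are increasing. [this work] -/
theorem isUpperSet_vc (Sp : Finset ι) (E : Finset (ι × ι)) :
    IsUpperSet {ω : Set ι | (↑Sp : Set ι) ⊆ ω ∧ ∀ ab ∈ E, ab.1 ∈ ω ∨ ab.2 ∈ ω} := by
  intro ω ω' hle h
  exact ⟨h.1.trans hle, fun ab hab => (h.2 ab hab).imp (fun h1 => hle h1) (fun h2 => hle h2)⟩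

/-- Vertex-cover events with forced set and edges inside `F` are `F`-determined. [this work] -/
theorem determinedBy_vc {F : Finset ι} {Sp : Finset ι} {E : Finset (ι × ι)} (hSp : Sp ⊆ F) (hE : ∀ ab ∈ E, ab.1 ∈ F ∧ ab.2 ∈ F) :
    DeterminedBy {ω : Set ι | (↑Sp : Set ι) ⊆ ω ∧ ∀ ab ∈ E, ab.1 ∈ ω ∨ ab.2 ∈ ω} (↑F : Set ι) := by
  rw [determinedBy_iff]
  intro ω ω' h
  have key : ∀ i ∈ F, (i ∈ ω ↔ i ∈ ω') := fun i hi => by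
    have hiF : i ∈ (↑F : Set ι) := Finset.mem_coe.2 hi
    exact ⟨fun hω => ((Set.ext_iff.1 h i).1 ⟨hω, hiF⟩).1, fun hω => ((Set.ext_iff.1 h i).2 ⟨hω, hiF⟩).1⟩
  simp only [Set.mem_setOf_eq, Set.subset_def, Finset.mem_coe]
  refine and_congr (forall₂_congr fun i hi => key i (hSp hi)) (forall₂_congr fun ab hab => ?_)
  rw [key _ (hE ab hab).1, key _ (hE ab hab).2]

/-- Inner section of a vertex-cover event at `e`: delete `e` (its forced membership and its edges disappear). [this work] -/
theorem section_insert_vc (Sp : Finset ι) (E : Finset (ι × ι)) (e : ι) :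
    {ω : Set ι | insert e ω ∈ {ω : Set ι | (↑Sp : Set ι) ⊆ ω ∧ ∀ ab ∈ E, ab.1 ∈ ω ∨ ab.2 ∈ ω}} =
      {ω : Set ι | (↑(Sp.erase e) : Set ι) ⊆ ω ∧ ∀ ab ∈ E.filter (fun ab => ab.1 ≠ e ∧ ab.2 ≠ e), ab.1 ∈ ω ∨ ab.2 ∈ ω} := by
  ext ω
  simp only [Set.mem_setOf_eq, Set.subset_def, Finset.mem_coe, Finset.mem_erase, Finset.mem_filter, Set.mem_insert_iff]
  constructor
  · rintro ⟨h1, h2⟩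
    refine ⟨fun i hi => (h1 i hi.2).resolve_left hi.1, fun ab hab => ?_⟩
    rcases h2 ab hab.1 with h | h
    · exact Or.inl (h.resolve_left hab.2.1)
    · exact Or.inr (h.resolve_left hab.2.2)
  · rintro ⟨h1, h2⟩
    refine ⟨fun i hi => ?_, fun ab hab => ?_⟩
    · by_cases hie : i = e
      · exact Or.inl hie
      · exact Or.inr (h1 i ⟨hie, hi⟩)
    · by_cases ha : ab.1 = e
      · exact Or.inl (Or.inl ha)
      · by_cases hb : ab.2 = e
        · exact Or.inr (Or.inl hb)
        · exact (h2 ab ⟨hab, ha, hb⟩).imp Or.inr Or.inr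

/-- Outer section at a forced coordinate is empty. [this work] -/
theorem section_sdiff_vc_of_mem (Sp : Finset ι) (E : Finset (ι × ι)) {e : ι} (he : e ∈ Sp) :
    {ω : Set ι | ω \ {e} ∈ {ω : Set ι | (↑Sp : Set ι) ⊆ ω ∧ ∀ ab ∈ E, ab.1 ∈ ω ∨ ab.2 ∈ ω}} = ∅ := by
  ext ω
  simp only [Set.mem_setOf_eq, Set.mem_empty_iff_false, iff_false, not_and]
  intro h
  exact absurd (h (Finset.mem_coe.2 he)) (fun hm => hm.2 rfl)

/-- Outer section at a degenerate edge `(e,e)` is empty. [this work] -/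
theorem section_sdiff_vc_of_loop (Sp : Finset ι) (E : Finset (ι × ι)) {e : ι} (he : (e, e) ∈ E) :
    {ω : Set ι | ω \ {e} ∈ {ω : Set ι | (↑Sp : Set ι) ⊆ ω ∧ ∀ ab ∈ E, ab.1 ∈ ω ∨ ab.2 ∈ ω}} = ∅ := by
  ext ω
  simp only [Set.mem_setOf_eq, Set.mem_empty_iff_false, iff_false, not_and]
  intro _ h
  rcases h (e, e) he with h1 | h1 <;> exact h1.2 rfl

/-- Outer section at a proper vertex `e` (not forced, no loop): the edges at `e` become forced neighbours, the other clauses stay, the forced set stays.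
[this work] -/
theorem section_sdiff_vc (Sp : Finset ι) (E : Finset (ι × ι)) {e : ι} (he : e ∉ Sp) (hloop : (e, e) ∉ E) :
    {ω : Set ι | ω \ {e} ∈ {ω : Set ι | (↑Sp : Set ι) ⊆ ω ∧ ∀ ab ∈ E, ab.1 ∈ ω ∨ ab.2 ∈ ω}} =
      {ω : Set ι | (↑(Sp ∪ ((E.filter fun ab => ab.1 = e).image Prod.snd ∪ (E.filter fun ab => ab.2 = e).image Prod.fst)) : Set ι) ⊆ ω ∧
        ∀ ab ∈ E.filter (fun ab => ab.1 ≠ e ∧ ab.2 ≠ e), ab.1 ∈ ω ∨ ab.2 ∈ ω} := by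
  ext ω
  simp only [Set.mem_setOf_eq, Set.subset_def, Finset.mem_coe, Finset.mem_union, Finset.mem_image, Finset.mem_filter, Set.mem_sdiff,
    Set.mem_singleton_iff, Prod.exists]
  constructor
  · rintro ⟨h1, h2⟩
    refine ⟨fun i hi => ?_, fun ab hab => ?_⟩
    · rcases hi with hi | ⟨a, b, ⟨hab, ha⟩, rfl⟩ | ⟨a, b, ⟨hab, hb⟩, rfl⟩
      · exact (h1 i hi).1
      · rcases h2 (a, b) hab with h | h
        · exact absurd ha h.2
        · exact h.1
      · rcases h2 (a, b) hab with h | h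
        · exact h.1
        · exact absurd hb h.2
    · exact (h2 ab hab.1).imp (fun h => h.1) (fun h => h.1)
  · rintro ⟨h1, h2⟩
    refine ⟨fun i hi => ⟨h1 i (Or.inl hi), fun hie => he (hie ▸ hi)⟩, fun ab hab => ?_⟩
    by_cases ha : ab.1 = e
    · by_cases hb : ab.2 = e
      · have hee : ab = (e, e) := Prod.ext ha hb
        exact absurd (hee ▸ hab) hloop
      · right
        exact ⟨h1 ab.2 (Or.inr (Or.inl ⟨ab.1, ab.2, ⟨hab, ha⟩, rfl⟩)), hb⟩
    · by_cases hb : ab.2 = e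
      · left
        exact ⟨h1 ab.1 (Or.inr (Or.inr ⟨ab.1, ab.2, ⟨hab, hb⟩, rfl⟩)), ha⟩
      · exact (h2 ab ⟨hab, ha, hb⟩).imp (fun h => ⟨h, ha⟩) (fun h => ⟨h, hb⟩)

/-- A vertex-cover event with a forced set is the same event without the forced set, cut by `{forced set ⊆ ω}`. [this work] -/
theorem vc_eq_inter_supset (Sp : Finset ι) (E : Finset (ι × ι)) :
    {ω : Set ι | (↑Sp : Set ι) ⊆ ω ∧ ∀ ab ∈ E, ab.1 ∈ ω ∨ ab.2 ∈ ω} =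
      {ω : Set ι | (↑(∅ : Finset ι) : Set ι) ⊆ ω ∧ ∀ ab ∈ E, ab.1 ∈ ω ∨ ab.2 ∈ ω} ∩ {ω : Set ι | (↑Sp : Set ι) ⊆ ω} := by
  ext ω
  simp only [Set.mem_setOf_eq, Set.mem_inter_iff, Finset.coe_empty, Set.empty_subset, true_and]
  tauto

end TwoCNF

end SahiOneStep

end Summit.CriticalPhenomena.PercolationContinuityZ3.Theorems
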